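import Mathlib.Analysis.SpecialFunctions.Integrals.Basic
import Mathlib.Analysis.SpecialFunctions.Trigonometric.Bounds
import Mathlib.Analysis.Real.Pi.Bounds
import Summits.HubbardSuperconductivity.HubbardSuperconductivity.Theorems.ThermalWedgeTwSeededEnsembleEquivalenceRFreeColdEdgeReduction

/-!
# Crux `TwSeededEnsembleEquivalenceR` (stmt-HubbardSuperconductivity-15581), line `cold-floor-collapse`
# (slug `Sketch`) — F1 `stub_freePairEnergyBandBottom`

Support file (`--supports stmt-HubbardSuperconductivity-15581`; sorry-free; no definition). It proves the
registered free-gas stub `stub_freePairEnergyBandBottom` (F1): at the band-bottom edge `μm = −79/20` the gain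
of the FREE (`U = 0`) `d`-wave-sourced BdG limit pressure
`I(β,μ,h) = (1/4π²)∫₀^{2π}∫₀^{2π} [2log2/β − ξ + (1/β)log((1+cosh βE)/2)] dθ₂dθ₁`
(`ξ = −2(cosθ₁+cosθ₂) − μ`, `E² = ξ² + 8h²(cosθ₁−cosθ₂)²`) from switching on the pairing source `h` obeys
`I(β,μm,h) − I(β,μm,0) ≤ 4h² + (√2/400)|h|` for every `β > 0` and every `h`.

Chain: per mode `(1/β)[log((1+cosh βE)/2) − log((1+cosh β|ξ|)/2)] ≤ E − |ξ|` (`log(1+cosh)` is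
`1`-Lipschitz, `fpe_log_cosh_gain_le`); with `a = 1 − cosθ₁`, `b = 1 − cosθ₂`, `ξ = 2(a+b) − 1/20`:
on `a + b ≥ 1/20`, `E − ξ ≤ 4h²(cosθ₁−cosθ₂)²/ξ ≤ 4h²(1 − cosθ₁cosθ₂)`; on `a + b < 1/20`,
`E − |ξ| ≤ √(8h²(a−b)²) ≤ (√2/10)|h|·1{a<1/20}1{b<1/20}` (`fpe_pointwise`). Integrating the majorant
(`fpe_iterated_integral_sub_le`): `∫₀^{2π}(1 − cosθ₁cosθ₂)dθ₂ = 2π` and the level set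
`{1 − cosθ < 1/20} ∩ [0,2π] ⊆ [0,2/5) ∪ (2π−2/5,2π]` (`cos x ≤ 1/√(x²+1)`), so `∫₀^{2π}1{1−cosθ<1/20} ≤ 4/5`
(`fpe_chi_integral_le`) and `(√2/10)|h|(4/5)²/(4π²) ≤ (√2/400)|h|`.
[folklore: BdG mean-field thermodynamics; elementary real analysis]
-/

set_option linter.dupNamespace false

namespace Summit.HubbardSuperconductivity.HubbardSuperconductivity.Theorems.TwSeededEnsembleEquivalenceR.ColdFloorLine

open Real MeasureTheory intervalIntegral

/-! ### Per-mode gain of the BdG pressure density -/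

/-- `1 + cosh y ≤ e^{y−x}(1 + cosh x)` for `x ≤ y`, i.e. `log(1 + cosh)` is `1`-Lipschitz. [folklore] -/
theorem fpe_one_add_cosh_le {x y : ℝ} (hxy : x ≤ y) :
    1 + Real.cosh y ≤ Real.exp (y - x) * (1 + Real.cosh x) := by
  have ha := Real.exp_pos x
  have hb := Real.exp_pos y
  have hab : Real.exp x ≤ Real.exp y := Real.exp_le_exp.2 hxy
  have key : Real.exp (y - x) * (1 + Real.cosh x) - (1 + Real.cosh y) =
      (Real.exp y - Real.exp x) * (2 * Real.exp x * Real.exp y + Real.exp x + Real.exp y) /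
        (2 * Real.exp x ^ 2 * Real.exp y) := by
    rw [Real.cosh_eq, Real.cosh_eq, Real.exp_sub, Real.exp_neg, Real.exp_neg]
    field_simp
    ring
  have hnn : 0 ≤ Real.exp (y - x) * (1 + Real.cosh x) - (1 + Real.cosh y) := by
    rw [key]
    exact div_nonneg (mul_nonneg (sub_nonneg.2 hab) (by positivity)) (by positivity)
  linarith

/-- Per-mode gain: `(1/β)[log((1+cosh βy)/2) − log((1+cosh βx)/2)] ≤ y − x` for `x ≤ y`, `β > 0`.
[folklore] -/
theorem fpe_log_cosh_gain_le {β x y : ℝ} (hβ : 0 < β) (hxy : x ≤ y) :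
    1 / β * Real.log ((1 + Real.cosh (β * y)) / 2) - 1 / β * Real.log ((1 + Real.cosh (β * x)) / 2) ≤
      y - x := by
  have hx1 : 0 < 1 + Real.cosh (β * x) := by have := Real.cosh_pos (β * x); linarith
  have hy1 : 0 < 1 + Real.cosh (β * y) := by have := Real.cosh_pos (β * y); linarith
  have key := fpe_one_add_cosh_le (mul_le_mul_of_nonneg_left hxy hβ.le)
  have hlog : Real.log (1 + Real.cosh (β * y)) ≤
      (β * y - β * x) + Real.log (1 + Real.cosh (β * x)) := by
    have h := Real.log_le_log hy1 key
    rwa [Real.log_mul (Real.exp_pos _).ne' hx1.ne', Real.log_exp] at h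
  rw [Real.log_div hy1.ne' two_ne_zero, Real.log_div hx1.ne' two_ne_zero, ← mul_sub, one_div,
    inv_mul_le_iff₀ hβ]
  linarith

/-- **Pointwise majorant of the per-mode gain at `μ = −79/20`.** With `c₁, c₂ ∈ [−1,1]` the two cosines,
`ξ = −2(c₁+c₂) + 79/20`, `E = √(ξ² + 8h²(c₁−c₂)²)`: the gain
`(1/β)[log((1+cosh βE)/2) − log((1+cosh β|ξ|)/2)]` is at most
`4h²(1 − c₁c₂) + (√2/10)|h|·1{1−c₁<1/20}·1{1−c₂<1/20}`. [folklore] -/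
theorem fpe_pointwise {β : ℝ} (hβ : 0 < β) (h c₁ c₂ : ℝ) (h1 : -1 ≤ c₁) (h1' : c₁ ≤ 1) (h2 : -1 ≤ c₂)
    (h2' : c₂ ≤ 1) :
    2 * Real.log 2 / β - (-2 * (c₁ + c₂) - (-(79 / 20) : ℝ)) + 1 / β * Real.log ((1 + Real.cosh (β * Real.sqrt ((-2 * (c₁ + c₂) - (-(79 / 20) : ℝ)) ^ 2 + (2 * Real.sqrt 2 * h * (c₁ - c₂)) ^ 2))) / 2) -
        (2 * Real.log 2 / β - (-2 * (c₁ + c₂) - (-(79 / 20) : ℝ)) + 1 / β * Real.log ((1 + Real.cosh (β * Real.sqrt ((-2 * (c₁ + c₂) - (-(79 / 20) : ℝ)) ^ 2 + (2 * Real.sqrt 2 * 0 * (c₁ - c₂)) ^ 2))) / 2)) ≤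
      4 * h ^ 2 * (1 - c₁ * c₂) +
        Real.sqrt 2 / 10 * |h| * (if 1 - c₁ < 1 / 20 then (1 : ℝ) else 0) * (if 1 - c₂ < 1 / 20 then (1 : ℝ) else 0) := by
  have h0 : (2 * Real.sqrt 2 * 0 * (c₁ - c₂)) ^ 2 = 0 := by ring
  rw [h0, add_zero, Real.sqrt_sq_eq_abs]
  set ξ : ℝ := -2 * (c₁ + c₂) - (-(79 / 20) : ℝ) with hξ
  set g : ℝ := 2 * Real.sqrt 2 * h * (c₁ - c₂) with hg
  have hs2 : Real.sqrt 2 ^ 2 = 2 := Real.sq_sqrt (by norm_num)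
  have hg2 : g ^ 2 = 8 * h ^ 2 * (c₁ - c₂) ^ 2 := by
    have e : g ^ 2 = Real.sqrt 2 ^ 2 * (4 * h ^ 2 * (c₁ - c₂) ^ 2) := by rw [hg]; ring
    rw [e, hs2]; ring
  have hE : |ξ| ≤ Real.sqrt (ξ ^ 2 + g ^ 2) := by
    rw [← Real.sqrt_sq_eq_abs]
    exact Real.sqrt_le_sqrt (by nlinarith [sq_nonneg g])
  have step1 := fpe_log_cosh_gain_le hβ hE
  have hχ₁ : 0 ≤ (if 1 - c₁ < 1 / 20 then (1 : ℝ) else 0) := by split_ifs <;> norm_num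
  have hχ₂ : 0 ≤ (if 1 - c₂ < 1 / 20 then (1 : ℝ) else 0) := by split_ifs <;> norm_num
  have hcc : 0 ≤ 1 - c₁ * c₂ := by
    nlinarith [mul_nonneg (sub_nonneg.2 h1') (show 0 ≤ 1 + c₂ by linarith),
      mul_nonneg (show 0 ≤ 1 + c₁ by linarith) (sub_nonneg.2 h2')]
  have hK : 0 ≤ Real.sqrt 2 / 10 * |h| := by positivity
  have hA : 0 ≤ 4 * h ^ 2 * (1 - c₁ * c₂) := mul_nonneg (by positivity) hcc
  rcases le_or_gt (1 / 20 : ℝ) ((1 - c₁) + (1 - c₂)) with hfar | hfar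
  · have hξpos : 0 < ξ := by rw [hξ]; linarith
    have habs : |ξ| = ξ := abs_of_pos hξpos
    rw [habs] at step1 ⊢
    have key : (c₁ - c₂) ^ 2 ≤ ξ * (1 - c₁ * c₂) := by
      nlinarith [mul_nonneg (mul_nonneg (sub_nonneg.2 h1') (sub_nonneg.2 h2'))
          (show 0 ≤ 4 - (1 - c₁) - (1 - c₂) by linarith),
        mul_nonneg (show 0 ≤ ξ - ((1 - c₁) + (1 - c₂)) by rw [hξ]; linarith) hcc]
    have hsq : ξ ^ 2 + g ^ 2 ≤ (ξ + 4 * h ^ 2 * (1 - c₁ * c₂)) ^ 2 := by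
      rw [hg2]
      nlinarith [mul_le_mul_of_nonneg_left key (by positivity : (0 : ℝ) ≤ 8 * h ^ 2),
        sq_nonneg (4 * h ^ 2 * (1 - c₁ * c₂))]
    have hE' : Real.sqrt (ξ ^ 2 + g ^ 2) ≤ ξ + 4 * h ^ 2 * (1 - c₁ * c₂) := by
      rw [← Real.sqrt_sq (by linarith : 0 ≤ ξ + 4 * h ^ 2 * (1 - c₁ * c₂))]
      exact Real.sqrt_le_sqrt hsq
    linarith [mul_nonneg (mul_nonneg hK hχ₁) hχ₂]
  · have ha : 1 - c₁ < 1 / 20 := by linarith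
    have hb : 1 - c₂ < 1 / 20 := by linarith
    simp only [if_pos ha, if_pos hb, mul_one]
    have hd : (c₁ - c₂) ^ 2 ≤ 1 / 400 := by
      nlinarith [mul_nonneg (show 0 ≤ 1 / 20 - (c₁ - c₂) by linarith)
        (show 0 ≤ 1 / 20 + (c₁ - c₂) by linarith)]
    have hsq : ξ ^ 2 + g ^ 2 ≤ (|ξ| + Real.sqrt 2 / 10 * |h|) ^ 2 := by
      have e : (|ξ| + Real.sqrt 2 / 10 * |h|) ^ 2 =
          |ξ| ^ 2 + 2 * (|ξ| * (Real.sqrt 2 / 10 * |h|)) + Real.sqrt 2 ^ 2 / 100 * |h| ^ 2 := by ring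
      rw [e, hs2, sq_abs, sq_abs, hg2]
      nlinarith [mul_nonneg (abs_nonneg ξ) hK,
        mul_le_mul_of_nonneg_left hd (by positivity : (0 : ℝ) ≤ 8 * h ^ 2)]
    have hE' : Real.sqrt (ξ ^ 2 + g ^ 2) ≤ |ξ| + Real.sqrt 2 / 10 * |h| := by
      rw [← Real.sqrt_sq (by positivity : 0 ≤ |ξ| + Real.sqrt 2 / 10 * |h|)]
      exact Real.sqrt_le_sqrt hsq
    linarith [hA]

/-! ### The level set `{1 − cos θ < 1/20}` and the Brillouin-zone bookkeeping -/

/-- On `[2/5, 2π − 2/5]` one has `cos θ ≤ 19/20` (from `cos x ≤ 1/√(x²+1)` on `|x| ≤ 3π/2`). [folklore] -/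
theorem fpe_cos_le_of_mem {θ : ℝ} (hθ1 : 2 / 5 ≤ θ) (hθ2 : θ ≤ 2 * π - 2 / 5) : Real.cos θ ≤ 19 / 20 := by
  have hπ := Real.pi_gt_three
  have key : ∀ x : ℝ, 2 / 5 ≤ x → x ≤ π → Real.cos x ≤ 19 / 20 := by
    intro x hx1 hx2
    have hb := Real.cos_le_one_div_sqrt_sq_add_one (x := x) (by linarith) (by linarith)
    have hs : (20 / 19 : ℝ) ≤ Real.sqrt (x ^ 2 + 1) := by
      rw [Real.le_sqrt' (by norm_num : (0 : ℝ) < 20 / 19)]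
      nlinarith
    calc Real.cos x ≤ 1 / Real.sqrt (x ^ 2 + 1) := hb
      _ ≤ 1 / (20 / 19) := one_div_le_one_div_of_le (by norm_num) hs
      _ = 19 / 20 := by norm_num
  rcases le_or_gt θ π with hle | hlt
  · exact key θ hθ1 hle
  · rw [← Real.cos_two_pi_sub]
    exact key (2 * π - θ) (by linarith) (by linarith)

/-- The indicator `1{1 − cos θ < 1/20}` is measurable. [folklore] -/
theorem fpe_chi_measurable : Measurable fun θ : ℝ => if 1 - Real.cos θ < 1 / 20 then (1 : ℝ) else 0 :=
  Measurable.ite (measurableSet_lt (continuous_const.sub Real.continuous_cos).measurable measurable_const)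
    measurable_const measurable_const

/-- The indicator `1{1 − cos θ < 1/20}` is interval integrable on every interval. [folklore] -/
theorem fpe_chi_intervalIntegrable (a b : ℝ) :
    IntervalIntegrable (fun θ : ℝ => if 1 - Real.cos θ < 1 / 20 then (1 : ℝ) else 0) volume a b := by
  refine IntervalIntegrable.mono_fun' (g := fun _ => (1 : ℝ)) intervalIntegrable_const
    fpe_chi_measurable.aestronglyMeasurable (Filter.Eventually.of_forall fun x => ?_)
  show ‖(if 1 - Real.cos x < 1 / 20 then (1 : ℝ) else 0)‖ ≤ 1
  split_ifs <;> simp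

/-- **Level-set lemma**: `∫₀^{2π} 1{1 − cos θ < 1/20} dθ ≤ 4/5`, since the level set avoids `[2/5, 2π − 2/5]`.
[folklore] -/
theorem fpe_chi_integral_le :
    ∫ θ in (0 : ℝ)..2 * π, (if 1 - Real.cos θ < 1 / 20 then (1 : ℝ) else 0) ≤ 4 / 5 := by
  have hπ := Real.pi_gt_three
  have hi := fpe_chi_intervalIntegrable
  have hb : ∀ a b : ℝ, ∫ θ in a..b, (if 1 - Real.cos θ < 1 / 20 then (1 : ℝ) else 0) ≤ |b - a| := by
    intro a b
    have h := intervalIntegral.norm_integral_le_of_norm_le_const (a := a) (b := b) (C := 1)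
      (f := fun θ : ℝ => if 1 - Real.cos θ < 1 / 20 then (1 : ℝ) else 0) (fun x _ => by
        show ‖(if 1 - Real.cos x < 1 / 20 then (1 : ℝ) else 0)‖ ≤ 1
        split_ifs <;> simp)
    rw [one_mul, Real.norm_eq_abs] at h
    exact (le_abs_self _).trans h
  have heq : Set.EqOn (fun θ : ℝ => if 1 - Real.cos θ < 1 / 20 then (1 : ℝ) else 0) (fun _ => 0)
      (Set.uIcc (2 / 5 : ℝ) (2 * π - 2 / 5)) := by
    intro x hx
    rw [Set.uIcc_of_le (by linarith)] at hx
    have hc := fpe_cos_le_of_mem hx.1 hx.2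
    show (if 1 - Real.cos x < 1 / 20 then (1 : ℝ) else 0) = 0
    rw [if_neg (by linarith)]
  have hmid : ∫ θ in (2 / 5 : ℝ)..(2 * π - 2 / 5), (if 1 - Real.cos θ < 1 / 20 then (1 : ℝ) else 0) = 0 := by
    rw [intervalIntegral.integral_congr heq, intervalIntegral.integral_zero]
  rw [← intervalIntegral.integral_add_adjacent_intervals (hi 0 (2 / 5)) (hi (2 / 5) (2 * π)),
    ← intervalIntegral.integral_add_adjacent_intervals (hi (2 / 5) (2 * π - 2 / 5)) (hi (2 * π - 2 / 5) (2 * π)),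
    hmid]
  have h1 := hb 0 (2 / 5)
  have h2 := hb (2 * π - 2 / 5) (2 * π)
  rw [sub_zero, abs_of_pos (by norm_num : (0 : ℝ) < 2 / 5)] at h1
  rw [show 2 * π - (2 * π - 2 / 5) = (2 / 5 : ℝ) by ring, abs_of_pos (by norm_num : (0 : ℝ) < 2 / 5)] at h2
  linarith

/-- **Brillouin-zone bookkeeping.** If `F − G ≤ A(1 − cosθ₁cosθ₂) + K·1{1−cosθ₁<1/20}·1{1−cosθ₂<1/20}`
pointwise with `F, G` jointly continuous and `K ≥ 0`, then
`∫₀^{2π}∫₀^{2π} F − ∫₀^{2π}∫₀^{2π} G ≤ 4π²A + K(4/5)²`. [folklore] -/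
theorem fpe_iterated_integral_sub_le {F G : ℝ → ℝ → ℝ} (hF : Continuous (Function.uncurry F))
    (hG : Continuous (Function.uncurry G)) {A K : ℝ} (hK : 0 ≤ K)
    (hpt : ∀ θ₁ θ₂, F θ₁ θ₂ - G θ₁ θ₂ ≤ A * (1 - Real.cos θ₁ * Real.cos θ₂) +
      K * (if 1 - Real.cos θ₁ < 1 / 20 then (1 : ℝ) else 0) * (if 1 - Real.cos θ₂ < 1 / 20 then (1 : ℝ) else 0)) :
    (∫ θ₁ in (0 : ℝ)..2 * π, ∫ θ₂ in (0 : ℝ)..2 * π, F θ₁ θ₂) -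
        (∫ θ₁ in (0 : ℝ)..2 * π, ∫ θ₂ in (0 : ℝ)..2 * π, G θ₁ θ₂) ≤
      2 * π * (2 * π * A) + K * (4 / 5) * (4 / 5) := by
  have hπ := Real.pi_pos
  have h2π : (0 : ℝ) ≤ 2 * π := by positivity
  have hχi := fpe_chi_intervalIntegrable
  have hχ0 : ∀ θ : ℝ, 0 ≤ (if 1 - Real.cos θ < 1 / 20 then (1 : ℝ) else 0) := fun θ => by
    split_ifs <;> norm_num
  have hJ := fpe_chi_integral_le
  have hFi : ∀ θ₁, IntervalIntegrable (fun θ₂ => F θ₁ θ₂) volume (0 : ℝ) (2 * π) := fun θ₁ =>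
    (hF.uncurry_left θ₁).intervalIntegrable _ _
  have hGi : ∀ θ₁, IntervalIntegrable (fun θ₂ => G θ₁ θ₂) volume (0 : ℝ) (2 * π) := fun θ₁ =>
    (hG.uncurry_left θ₁).intervalIntegrable _ _
  have hFo : Continuous fun θ₁ => ∫ θ₂ in (0 : ℝ)..2 * π, F θ₁ θ₂ :=
    intervalIntegral.continuous_parametric_intervalIntegral_of_continuous' hF 0 (2 * π)
  have hGo : Continuous fun θ₁ => ∫ θ₂ in (0 : ℝ)..2 * π, G θ₁ θ₂ :=
    intervalIntegral.continuous_parametric_intervalIntegral_of_continuous' hG 0 (2 * π)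
  -- inner integral
  have hinner : ∀ θ₁, (∫ θ₂ in (0 : ℝ)..2 * π, F θ₁ θ₂) - (∫ θ₂ in (0 : ℝ)..2 * π, G θ₁ θ₂) ≤
      2 * π * A + K * (4 / 5) * (if 1 - Real.cos θ₁ < 1 / 20 then (1 : ℝ) else 0) := by
    intro θ₁
    have hc : Continuous fun θ₂ : ℝ => A * (1 - Real.cos θ₁ * Real.cos θ₂) := by fun_prop
    have h2i : IntervalIntegrable (fun θ₂ : ℝ => K * (if 1 - Real.cos θ₁ < 1 / 20 then (1 : ℝ) else 0) *
        (if 1 - Real.cos θ₂ < 1 / 20 then (1 : ℝ) else 0)) volume (0 : ℝ) (2 * π) := (hχi _ _).const_mul _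
    have hI1 : ∫ θ₂ in (0 : ℝ)..2 * π, A * (1 - Real.cos θ₁ * Real.cos θ₂) = 2 * π * A := by
      rw [intervalIntegral.integral_const_mul, intervalIntegral.integral_sub intervalIntegrable_const
        ((Real.continuous_cos.intervalIntegrable _ _).const_mul _), integral_one,
        intervalIntegral.integral_const_mul, integral_cos, Real.sin_two_pi, Real.sin_zero]
      ring
    rw [← intervalIntegral.integral_sub (hFi θ₁) (hGi θ₁)]
    calc ∫ θ₂ in (0 : ℝ)..2 * π, (F θ₁ θ₂ - G θ₁ θ₂)
        ≤ ∫ θ₂ in (0 : ℝ)..2 * π, (A * (1 - Real.cos θ₁ * Real.cos θ₂) +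
            K * (if 1 - Real.cos θ₁ < 1 / 20 then (1 : ℝ) else 0) * (if 1 - Real.cos θ₂ < 1 / 20 then (1 : ℝ) else 0)) :=
          intervalIntegral.integral_mono_on h2π ((hFi θ₁).sub (hGi θ₁)) ((hc.intervalIntegrable _ _).add h2i)
            fun θ₂ _ => hpt θ₁ θ₂
      _ = 2 * π * A + K * (if 1 - Real.cos θ₁ < 1 / 20 then (1 : ℝ) else 0) *
            ∫ θ₂ in (0 : ℝ)..2 * π, (if 1 - Real.cos θ₂ < 1 / 20 then (1 : ℝ) else 0) := by
          rw [intervalIntegral.integral_add (hc.intervalIntegrable _ _) h2i, hI1, intervalIntegral.integral_const_mul]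
      _ ≤ 2 * π * A + K * (4 / 5) * (if 1 - Real.cos θ₁ < 1 / 20 then (1 : ℝ) else 0) := by
          nlinarith [mul_le_mul_of_nonneg_left hJ (mul_nonneg hK (hχ0 θ₁))]
  -- outer integral
  rw [← intervalIntegral.integral_sub (hFo.intervalIntegrable _ _) (hGo.intervalIntegrable _ _)]
  calc ∫ θ₁ in (0 : ℝ)..2 * π, ((∫ θ₂ in (0 : ℝ)..2 * π, F θ₁ θ₂) - ∫ θ₂ in (0 : ℝ)..2 * π, G θ₁ θ₂)
      ≤ ∫ θ₁ in (0 : ℝ)..2 * π, (2 * π * A + K * (4 / 5) * (if 1 - Real.cos θ₁ < 1 / 20 then (1 : ℝ) else 0)) :=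
        intervalIntegral.integral_mono_on h2π ((hFo.intervalIntegrable _ _).sub (hGo.intervalIntegrable _ _))
          (intervalIntegrable_const.add ((hχi _ _).const_mul _)) fun θ₁ _ => hinner θ₁
    _ = (2 * π - 0) * (2 * π * A) +
          K * (4 / 5) * ∫ θ₁ in (0 : ℝ)..2 * π, (if 1 - Real.cos θ₁ < 1 / 20 then (1 : ℝ) else 0) := by
        rw [intervalIntegral.integral_add intervalIntegrable_const ((hχi _ _).const_mul _),
          intervalIntegral.integral_const, smul_eq_mul, intervalIntegral.integral_const_mul]
    _ ≤ 2 * π * (2 * π * A) + K * (4 / 5) * (4 / 5) := by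
        nlinarith [mul_le_mul_of_nonneg_left hJ (by positivity : (0 : ℝ) ≤ K * (4 / 5))]

/-! ### F1 -/

/-- **F1 (`stub_freePairEnergyBandBottom`): pair-energy bound of the free `d`-wave-sourced BdG limit pressure at
the band-bottom edge `μm = −79/20`.** With `I(β,μ,h)` the Brillouin-zone average of
`2log2/β − ξ + (1/β)log((1+cosh βE)/2)` (`ξ = −2(cosθ₁+cosθ₂) − μ`, `E² = ξ² + 8h²(cosθ₁−cosθ₂)²`):
`I(β,μm,h) − I(β,μm,0) ≤ 4h² + (√2/400)|h|` for all `β > 0`, `h ∈ ℝ`. [folklore: BdG mean-field thermodynamics] -/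
theorem stub_freePairEnergyBandBottom :
    ∀ (β h : ℝ), 0 < β →
      (∫ θ₁ in (0 : ℝ)..2 * π, ∫ θ₂ in (0 : ℝ)..2 * π, (2 * Real.log 2 / β - (-2 * (Real.cos θ₁ + Real.cos θ₂) - (-(79 / 20) : ℝ)) + 1 / β * Real.log ((1 + Real.cosh (β * Real.sqrt ((-2 * (Real.cos θ₁ + Real.cos θ₂) - (-(79 / 20) : ℝ)) ^ 2 + (2 * Real.sqrt 2 * h * (Real.cos θ₁ - Real.cos θ₂)) ^ 2))) / 2))) / (4 * π ^ 2) -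
        (∫ θ₁ in (0 : ℝ)..2 * π, ∫ θ₂ in (0 : ℝ)..2 * π, (2 * Real.log 2 / β - (-2 * (Real.cos θ₁ + Real.cos θ₂) - (-(79 / 20) : ℝ)) + 1 / β * Real.log ((1 + Real.cosh (β * Real.sqrt ((-2 * (Real.cos θ₁ + Real.cos θ₂) - (-(79 / 20) : ℝ)) ^ 2 + (2 * Real.sqrt 2 * 0 * (Real.cos θ₁ - Real.cos θ₂)) ^ 2))) / 2))) / (4 * π ^ 2) ≤
      4 * h ^ 2 + Real.sqrt 2 / 400 * |h| := by
  intro β h hβ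
  have hπ := Real.pi_gt_three
  have hpos : (0 : ℝ) < 4 * π ^ 2 := by positivity
  rw [← sub_div, div_le_iff₀ hpos]
  have hmain := fpe_iterated_integral_sub_le (A := 4 * h ^ 2) (K := Real.sqrt 2 / 10 * |h|)
    (cfl_continuous_bdgPressureDensity β (-(79 / 20)) h) (cfl_continuous_bdgPressureDensity β (-(79 / 20)) 0)
    (by positivity) (fun θ₁ θ₂ => fpe_pointwise hβ h (Real.cos θ₁) (Real.cos θ₂) (Real.neg_one_le_cos θ₁)
      (Real.cos_le_one θ₁) (Real.neg_one_le_cos θ₂) (Real.cos_le_one θ₂))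
  refine hmain.trans ?_
  have hs : (0 : ℝ) ≤ Real.sqrt 2 * |h| := by positivity
  nlinarith [mul_nonneg hs (show (0 : ℝ) ≤ π ^ 2 - 9 by nlinarith), hs]

end Summit.HubbardSuperconductivity.HubbardSuperconductivity.Theorems.TwSeededEnsembleEquivalenceR.ColdFloorLine
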